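import Summits.ValiantsHypothesis.ValiantsHypothesis.Theorems.MonotoneRestorationOrbitRestorationQPRestorationOnUniform
import Literature.Computability.AlgebraicComplexity.HomogeneousComponentsComplexity
import Literature.Computability.AlgebraicComplexity.DepthReductionProofs
import HarnessLib

/-!
# The crux `OrbitRestorationQP` reduces to HOMOGENEOUS polynomials (stmt-ValiantsHypothesis-18293)

Namespace `Summit.ValiantsHypothesis.ValiantsHypothesis.Theorems.OrbitRestorationQPDepthThreeRung.UniformForm`.

With the crux in uniform levelwise form (`orbitRestorationQP_iff_uniform`, landed) and the landed closure rules — the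
slice `VPClass n c` (degree and Bürgisser complexity `≤ n^c + c`) is closed under homogeneous components uniformly
(BCS Lemma 21.25 in the tree: `complexity_homogeneousComponent_le_sq_mul`, `L(f^{(d)}) ≤ (d+2)²·L(f)`), homogeneous
components of matrix-symmetric polynomials are matrix-symmetric, and `QPOrbitRestorable` is closed under finite sums at
uniform cost — the crux itself becomes a statement about HOMOGENEOUS invariant polynomials:

* `exists_vpClass_homogeneousComponent` — `∀ c ∃ c' ∀ n q d, VPClass n c q → VPClass n c' (Hom_d q)`;
* `orbitRestorationQP_iff_homogeneous` — **`OrbitRestorationQP ⟺ ∀ c ∃ c' ∀ n ∀ q`, (`q` matrix-symmetric, HOMOGENEOUS,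
  `deg q ≤ n^c + c`, `complexity q ≤ n^c + c`) `→ QPOrbitRestorable c' n q`.**

Honest label: a reformulation of the crux (same strength: it still implies VH through the route's `closes`); no stub is
closed; VP ≠ VNP is not touched. [cite: BurgisserClausenShokrollahi1997, Lemma (21.25)]
-/

noncomputable section

open scoped Classical

-- `Summit.ValiantsHypothesis.ValiantsHypothesis.…` is the tree's single-conjunct layout (Sub = Summit).
set_option linter.dupNamespace false

namespace Summit.ValiantsHypothesis.ValiantsHypothesis.Theorems.OrbitRestorationQPDepthThreeRung

namespace UniformForm

open Literature.Computability.AlgebraicComplexity Literature.Computability.AlgebraicComplexity.DepthReduction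
open MvPolynomial
open Summit.ValiantsHypothesis.ValiantsHypothesis.Theorems
open Summit.ValiantsHypothesis.ValiantsHypothesis.Theses.MonotoneRestoration

/-- **`VPClass` is closed under homogeneous components, uniformly in the level** (BCS Lemma 21.25). [cite: BurgisserClausenShokrollahi1997, Lemma (21.25)] -/
theorem exists_vpClass_homogeneousComponent (c : ℕ) : ∃ c' : ℕ,
    ∀ (n : ℕ) (q : MvPolynomial (Fin n × Fin n) ℂ) (d : ℕ), VPClass n c q → VPClass n c' (homogeneousComponent d q) := by
  refine ⟨2 * (3 * c + 5) + 3 ^ (3 * c + 5), fun n q d hq => ?_⟩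
  obtain ⟨hdeg, hcx⟩ := hq
  set B := n + 2 with hB
  have hB2 : 2 ≤ B := by omega
  have hBpos : ∀ e, 1 ≤ B ^ e := fun e => Nat.one_le_pow _ _ (by omega)
  have hp : n ^ c + c ≤ 2 * B ^ c := le_two_mul_pow (le_refl _) (le_refl c)
  have hp1 : n ^ c + c ≤ B ^ (c + 1) := by
    calc n ^ c + c ≤ 2 * B ^ c := hp
      _ ≤ B * B ^ c := Nat.mul_le_mul_right _ hB2
      _ = B ^ (c + 1) := by ring
  have hfinal : B ^ (3 * c + 5) ≤ n ^ (2 * (3 * c + 5) + 3 ^ (3 * c + 5)) + (2 * (3 * c + 5) + 3 ^ (3 * c + 5)) := by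
    have h := vsbr_pow_base_le n (3 * c + 5)
    have h3 : 3 ^ (3 * c + 5) ≤ 2 * (3 * c + 5) + 3 ^ (3 * c + 5) := Nat.le_add_left _ _
    rcases Nat.eq_zero_or_pos n with hn0 | hn
    · subst hn0
      have e1 : (0 : ℕ) ^ (2 * (3 * c + 5)) = 0 := zero_pow (by omega)
      have e2 : (0 : ℕ) ^ (2 * (3 * c + 5) + 3 ^ (3 * c + 5)) = 0 :=
        zero_pow (by positivity : 0 < 2 * (3 * c + 5) + 3 ^ (3 * c + 5)).ne'
      rw [e1] at h
      rw [e2]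
      exact h.trans (Nat.add_le_add_left h3 0)
    · exact h.trans (Nat.add_le_add (Nat.pow_le_pow_right hn (Nat.le_add_right _ _)) h3)
  have hcc : c ≤ 2 * (3 * c + 5) + 3 ^ (3 * c + 5) := le_trans (by omega) (Nat.le_add_right (2 * (3 * c + 5)) _)
  by_cases hd : q.totalDegree < d
  · rw [homogeneousComponent_eq_zero _ _ hd]
    refine ⟨by simp, ?_⟩
    have h0 : complexity (C (0 : ℂ) : MvPolynomial (Fin n × Fin n) ℂ) = 0 := complexity_C_holds 0
    rw [C_0] at h0
    rw [h0]
    exact Nat.zero_le _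
  push Not at hd
  refine ⟨?_, ?_⟩
  · -- degree
    exact ((homogeneousComponent_isHomogeneous d q).totalDegree_le.trans hd).trans
      (hdeg.trans (vsbr_pbound_mono hcc n))
  · -- complexity, BCS (21.25)
    refine (complexity_homogeneousComponent_le_sq_mul q d).trans ?_
    have hd' : d + 2 ≤ B ^ (c + 2) := by
      calc d + 2 ≤ n ^ c + c + 2 := by omega
        _ ≤ B ^ (c + 1) + B ^ (c + 1) := Nat.add_le_add hp1 ((hB2.trans (by
            calc B = B ^ 1 := (pow_one B).symm
              _ ≤ B ^ (c + 1) := Nat.pow_le_pow_right (by omega) (by omega))))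
        _ = 2 * B ^ (c + 1) := by ring
        _ ≤ B * B ^ (c + 1) := Nat.mul_le_mul_right _ hB2
        _ = B ^ (c + 2) := by ring
    calc (d + 2) ^ 2 * complexity q ≤ (B ^ (c + 2)) ^ 2 * B ^ (c + 1) :=
          Nat.mul_le_mul (Nat.pow_le_pow_left hd' 2) (hcx.trans hp1)
      _ = B ^ (3 * c + 5) := by ring
      _ ≤ _ := hfinal

/-- Homogeneous components of a matrix-symmetric polynomial are matrix-symmetric. [folklore] -/
theorem matrixSymmetric_homogeneousComponent {n : ℕ} {q : MvPolynomial (Fin n × Fin n) ℂ}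
    (hq : ∀ σ τ : Equiv.Perm (Fin n), rename (fun p : Fin n × Fin n => (σ p.1, τ p.2)) q = q) (d : ℕ)
    (σ τ : Equiv.Perm (Fin n)) :
    rename (fun p : Fin n × Fin n => (σ p.1, τ p.2)) (homogeneousComponent d q) = homogeneousComponent d q := by
  rw [rename_homogeneousComponent, hq σ τ]

/-- **THE CRUX REDUCES TO HOMOGENEOUS POLYNOMIALS.**  `OrbitRestorationQP` holds iff for every exponent `c` there is one
constant `c'` such that every HOMOGENEOUS matrix-symmetric polynomial on the `n × n` matrix with degree and complexity
`≤ n^c + c` is `QPOrbitRestorable c' n`. [cite: BurgisserClausenShokrollahi1997, Lemma (21.25)] -/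
theorem orbitRestorationQP_iff_homogeneous :
    OrbitRestorationQP ↔
    (∀ c : ℕ, ∃ c' : ℕ, ∀ (n : ℕ) (q : MvPolynomial (Fin n × Fin n) ℂ),
        (∀ σ τ : Equiv.Perm (Fin n), MvPolynomial.rename (fun p : Fin n × Fin n => (σ p.1, τ p.2)) q = q) →
        (∃ d : ℕ, q.IsHomogeneous d) →
        q.totalDegree ≤ n ^ c + c → complexity q ≤ n ^ c + c → QPOrbitRestorable c' n q) := by
  rw [orbitRestorationQP_iff_uniform]
  constructor
  · intro hU c
    obtain ⟨c', hc'⟩ := hU c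
    exact ⟨c', fun n q hs _ hd hx => hc' n q hs hd hx⟩
  · intro hH c
    obtain ⟨c₁, hc₁⟩ := exists_vpClass_homogeneousComponent c
    obtain ⟨c', hc'⟩ := hH c₁
    refine ⟨c' + 3, fun n q hs hd hx => ?_⟩
    rw [← sum_homogeneousComponent q]
    exact ValueOrbit.qpOrbitRestorable_finset_sum _ _ fun k _ =>
      hc' n _ (matrixSymmetric_homogeneousComponent hs k) ⟨k, homogeneousComponent_isHomogeneous k q⟩
        (hc₁ n q k ⟨hd, hx⟩).1 (hc₁ n q k ⟨hd, hx⟩).2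

end UniformForm

end Summit.ValiantsHypothesis.ValiantsHypothesis.Theorems.OrbitRestorationQPDepthThreeRung

end
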